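import Summits.CriticalPhenomena.Ising3DConformalLimit.Theorems.PrimaryAtInfinityWardToMoebiusPullback
import HarnessLib

/-!
# Möbius covariance ⇒ weak special-conformal Ward identity on `U₀` (`K = ι P ι` at the weak level)

Stub F1 `stub_wardOnU0` of line `Sketch` v9 ("Ward door") for crux `MoebiusLimitExists`
(stmt-CriticalPhenomena-1344), lead prover-line-stmt-CriticalPhenomena-1344-c16-0; THEOREM-ONLY,
`--supports stmt-CriticalPhenomena-1344`.

Let `F : (ℝ³)ⁿ → ℝ` be inversion covariant with weight `Δ` at configurations avoiding the origin,
`F(ιₙ x) = (∏ᵢ ‖xᵢ‖^{2Δ}) F(x)` (`ι = EuclideanGeometry.inversion 0 1`, `ιₙ` coordinatewise), and satisfy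
the weak translation identities `∫ F · Dφ[(v,…,v)] = 0` for smooth `φ` compactly supported in the
non-coincident configurations. Then `F` satisfies the weak special-conformal Ward identity with weight
`Δ`, `∫ F [(2Δ−6)(Σᵢ ⟪b,yᵢ⟫) ψ + Dψ[(‖yᵢ‖² b − 2⟪b,yᵢ⟫ yᵢ)ᵢ]] = 0`, for every smooth `ψ` compactly
supported in `U₀ = NonCoincident ∩ {∀ i, yᵢ ≠ 0}` (`stub_wardOnU0`). Proof: test the translation
identity in direction `b` against `φ = (∏ᵢ ‖xᵢ‖^{2Δ−6}) · ψ(ιₙ x)`; by `Dιₙ(y)[K_b y] = (b,…,b)` at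
`y = ιₙ x` and `ιₙ ιₙ = id` one has `D(ψ ∘ ιₙ)(x)[(b,…,b)] = Dψ(ιₙ x)[K_b(ιₙ x)]`, and
`D(∏ᵢ ‖xᵢ‖^p)[(b,…,b)] = p (Σᵢ ⟪b, ι xᵢ⟫) ∏ᵢ ‖xᵢ‖^p`; then change variables `x = ιₙ y` (Jacobian
`∏ᵢ ‖yᵢ‖⁻⁶`, `integral_comp_invConfig`) and cancel the weights against inversion covariance. This is the
infinitesimal `K_b = ι P_b ι` of Di Francesco–Mathieu–Sénéchal 1997 §4.1 (4.14)–(4.18), run in the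
direction "covariance ⇒ Ward" (the tree file `PrimaryAtInfinityWardToMoebiusPullback` runs it the other
way); all the calculus is reused from `PrimaryAtInfinityWardToMoebius{InvMeasure,Pullback}`.

References: Di Francesco–Mathieu–Sénéchal, *Conformal Field Theory* (1997) §4.1
[FrancescoMathieuSenechal1997]; the calculus is folklore. No definitions, no `sorry`.
-/

noncomputable section

open Filter Topology MeasureTheory
open Literature.Probability.LatticeModels
open EuclideanGeometry
open scoped RealInnerProductSpace

namespace Summit.CriticalPhenomena.Ising3DConformalLimit.MoebiusLimitExistsSketchV9

open Summit.CriticalPhenomena.Ising3DConformalLimit.WardToMoebius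

variable {n : ℕ}

/-- Derivative of `ψ ∘ ιₙ` along a constant field `(a,…,a)`: it is the derivative of `ψ` at `ιₙ x`
along the special-conformal field `K_a(ιₙ x) = (‖ι xᵢ‖² a − 2⟪a, ι xᵢ⟫ ι xᵢ)ᵢ`, for a test function
`ψ` compactly supported in `U₀` (`K_a = ι P_a ι`; from `testFunction_comp_invConfig` applied to
`ψ ∘ ιₙ` and `ιₙ ιₙ = id`). [folklore] -/
theorem fderiv_comp_invConfig_const {ψ : (Fin n → EuclideanSpace ℝ (Fin 3)) → ℝ}
    (hψ : ContDiff ℝ ((⊤ : ℕ∞) : WithTop ℕ∞) ψ) (hψc : HasCompactSupport ψ)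
    (hψU : tsupport ψ ⊆ {x | x ∈ NonCoincident 3 n ∧ ∀ i, x i ≠ 0})
    (a : EuclideanSpace ℝ (Fin 3)) (x : Fin n → EuclideanSpace ℝ (Fin 3)) :
    fderiv ℝ (fun y : Fin n → EuclideanSpace ℝ (Fin 3) =>
        ψ (fun i => inversion (0 : EuclideanSpace ℝ (Fin 3)) 1 (y i))) x (fun _ => a)
      = fderiv ℝ ψ (fun i => inversion (0 : EuclideanSpace ℝ (Fin 3)) 1 (x i))
          (fun i => ‖inversion (0 : EuclideanSpace ℝ (Fin 3)) 1 (x i)‖ ^ 2 • a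
            - (2 * ⟪a, inversion (0 : EuclideanSpace ℝ (Fin 3)) 1 (x i)⟫) •
              inversion (0 : EuclideanSpace ℝ (Fin 3)) 1 (x i)) := by
  obtain ⟨hg, hgc, hgU, -⟩ := testFunction_comp_invConfig hψ hψc hψU
  obtain ⟨-, -, -, hd⟩ := testFunction_comp_invConfig hg hgc hgU
  have key := hd a (fun i => inversion (0 : EuclideanSpace ℝ (Fin 3)) 1 (x i))
  simp only [inversion_zero_one_inversion] at key
  exact key.symm

/-- Directional derivative, along a constant field `(b,…,b)` and at a configuration avoiding the
origin, of the test function `x ↦ (∏ᵢ ‖xᵢ‖^q) ψ(ιₙ x)`: it equals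
`(∏ᵢ ‖xᵢ‖^q) · (q (Σᵢ ⟪b, ι xᵢ⟫) ψ(ιₙ x) + Dψ(ιₙ x)[K_b(ιₙ x)])`. [folklore] -/
theorem fderiv_normWeight_mul_comp_invConfig_const (q : ℝ)
    {ψ : (Fin n → EuclideanSpace ℝ (Fin 3)) → ℝ}
    (hψ : ContDiff ℝ ((⊤ : ℕ∞) : WithTop ℕ∞) ψ) (hψc : HasCompactSupport ψ)
    (hψU : tsupport ψ ⊆ {x | x ∈ NonCoincident 3 n ∧ ∀ i, x i ≠ 0})
    (b : EuclideanSpace ℝ (Fin 3)) (x : Fin n → EuclideanSpace ℝ (Fin 3)) :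
    fderiv ℝ (fun y : Fin n → EuclideanSpace ℝ (Fin 3) =>
        (∏ i, ‖y i‖ ^ q) * ψ (fun i => inversion (0 : EuclideanSpace ℝ (Fin 3)) 1 (y i))) x
        (fun _ => b)
      = (∏ i, ‖x i‖ ^ q) *
          (q * (∑ i, ⟪b, inversion (0 : EuclideanSpace ℝ (Fin 3)) 1 (x i)⟫) *
              ψ (fun i => inversion (0 : EuclideanSpace ℝ (Fin 3)) 1 (x i)) +
            fderiv ℝ ψ (fun i => inversion (0 : EuclideanSpace ℝ (Fin 3)) 1 (x i))
              (fun i => ‖inversion (0 : EuclideanSpace ℝ (Fin 3)) 1 (x i)‖ ^ 2 • b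
                - (2 * ⟪b, inversion (0 : EuclideanSpace ℝ (Fin 3)) 1 (x i)⟫) •
                  inversion (0 : EuclideanSpace ℝ (Fin 3)) 1 (x i))) := by
  obtain ⟨hg, hgc, hgU, -⟩ := testFunction_comp_invConfig hψ hψc hψU
  obtain ⟨-, -, -, hd⟩ := testFunction_normWeight_mul q hg hgc hgU
  rw [hd x (fun _ => b), fderiv_comp_invConfig_const hψ hψc hψU b x]
  have hsum : ∑ i, ⟪x i, b⟫ / ‖x i‖ ^ 2
      = ∑ i, ⟪b, inversion (0 : EuclideanSpace ℝ (Fin 3)) 1 (x i)⟫ :=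
    Finset.sum_congr rfl fun i _ => by
      have h := inner_inversion_div_norm_sq (inversion (0 : EuclideanSpace ℝ (Fin 3)) 1 (x i)) b
      rw [inversion_zero_one_inversion] at h
      rw [h, real_inner_comm]
  rw [hsum]
  ring

/-- **STUB F1 — `stub_wardOnU0`.**  `K = ι P ι` at the weak level: if `F` is continuous off the
diagonals, inversion covariant with weight `Δ` at configurations avoiding the origin, and satisfies
the weak translation identities, then it satisfies the weak special-conformal Ward identity with
weight `Δ` for every test function supported in `NonCoincident ∩ {∀ i, xᵢ ≠ 0}` (test the translation
identity in direction `b` against `φ = (∏ᵢ ‖xᵢ‖^{2Δ−6}) ψ(ιₙ x)`, use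
`D(‖x‖^p)[b] = p ‖x‖^p ⟪ιx, b⟫` and `Dι(x)[b] = K_b(ιx)`, change variables `x = ιₙ y` with Jacobian
`∏ ‖yᵢ‖⁻⁶`, and cancel the weight against inversion covariance).
[cite: FrancescoMathieuSenechal1997, §4.1 (4.14)–(4.18)] -/
theorem stub_wardOnU0 :
    ∀ (n : ℕ) (F : (Fin n → EuclideanSpace ℝ (Fin 3)) → ℝ) (Δ : ℝ),
      ContinuousOn F (NonCoincident 3 n) →
      (∀ x : Fin n → EuclideanSpace ℝ (Fin 3), (∀ i, x i ≠ 0) →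
        F (fun i => EuclideanGeometry.inversion 0 1 (x i)) = (∏ i, ‖x i‖ ^ (2 * Δ)) * F x) →
      (∀ (v : EuclideanSpace ℝ (Fin 3)) (φ : (Fin n → EuclideanSpace ℝ (Fin 3)) → ℝ),
        ContDiff ℝ ((⊤ : ℕ∞) : WithTop ℕ∞) φ → HasCompactSupport φ → tsupport φ ⊆ NonCoincident 3 n →
        ∫ x, F x * fderiv ℝ φ x (fun _ => v) = 0) →
      ∀ (b : EuclideanSpace ℝ (Fin 3)) (φ : (Fin n → EuclideanSpace ℝ (Fin 3)) → ℝ),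
        ContDiff ℝ ((⊤ : ℕ∞) : WithTop ℕ∞) φ → HasCompactSupport φ →
        tsupport φ ⊆ NonCoincident 3 n ∩ {x | ∀ i, x i ≠ 0} →
        ∫ x, F x * ((2 * Δ - 6) * (∑ i, inner ℝ b (x i)) * φ x +
          fderiv ℝ φ x (fun i => ‖x i‖ ^ 2 • b - (2 * inner ℝ b (x i)) • x i)) = 0 := by
  intro n F Δ _ hinv htr b ψ hψ hψc hψU
  have hψU' : tsupport ψ ⊆ {x | x ∈ NonCoincident 3 n ∧ ∀ i, x i ≠ 0} :=
    fun x hx => ⟨(hψU hx).1, (hψU hx).2⟩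
  -- the test function `φ = (∏ᵢ ‖xᵢ‖^{2Δ−6}) · ψ(ιₙ x)` of the translation identity
  obtain ⟨hg, hgc, hgU, -⟩ := testFunction_comp_invConfig hψ hψc hψU'
  obtain ⟨hφ, hφc, hφU, -⟩ := testFunction_normWeight_mul (2 * Δ - 6) hg hgc hgU
  have key := htr b _ hφ hφc (hφU.trans fun x hx => hx.1)
  -- change variables `x = ιₙ y` in the goal and compare integrands at configurations avoiding `0`
  rw [integral_comp_invConfig]
  refine (integral_congr_ae (ae_forall_ne_zero.mono fun x hx => ?_)).trans key
  beta_reduce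
  rw [fderiv_normWeight_mul_comp_invConfig_const (2 * Δ - 6) hψ hψc hψU' b x, hinv x hx]
  have hw : (∏ i, ‖x i‖ ^ (-6 : ℝ)) * ∏ i, ‖x i‖ ^ (2 * Δ) = ∏ i, ‖x i‖ ^ (2 * Δ - 6) := by
    rw [normWeight_mul hx]; congr 1; ext i; congr 1; ring
  rw [← hw]
  ring

end Summit.CriticalPhenomena.Ising3DConformalLimit.MoebiusLimitExistsSketchV9
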